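import Mathlib.Algebra.BigOperators.Group.Finset.Basic
import Mathlib.Algebra.BigOperators.Ring.Finset
import Mathlib.Data.Fintype.BigOperators
import Mathlib.Data.Finset.Prod
import Mathlib.Tactic
import HarnessLib

/-!
# Venture HSemireg — the circulant (2, 6) design and its blow-ups: THEOREM L is attained on the ray `t = 3d`

Cell `pub-hsemireg`, widening group W5, seat w5-n7-1 (gen 12); files of record `widen/W5/N7-FEASIBILITY-w5n7.md`
(N7F) §3.9 (d) «MIN/MAX TABLE — ΣN(C₄) over ALL triangle-free flat designs on four coordinates … flat-2 … u = 6: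
[72, 108] vs 48 … Circulant sub-census (circ4.py, exhaustive over ℤ/u difference families): flat-2 u = 5 / 6 / 7:
ΣN(C₄) ∈ {90} / [72, 108] / [63, 126]» and `widen/W5/FLATTF-w5n62g17.md` §0/§4 (THEOREM L: `12 t d³ ≤ 2 ΣN(C₄) +
3 t² d²`, i.e. ΣN(C₄) ≥ (3/2) t d² (4d − t) — at (2, 6) the bound is 72); tree leg
`Summits/Ventures/HSemireg/FlatTriangleFreeFourCycles.lean` (`twelve_mul_le`), whose shapes are reused; companion legs
`FlatDesignBlowUp` (x = 2), `FlatDesignPentagon` (x = 5/2) of this seat.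

THE HEXAGON DESIGN (a circulant (d, t) = (2, 6) design found by exhaustive search over ℤ/6-difference families at this
seat: of the triangle-free families 1 728 have ΣN(C₄) = 72, the minimum, matching N7F's circulant sub-census
[72, 108]). All four coordinates are `Fin 6`; `nAB = nAC = nAD = fun a => {a, a + 3}` (difference set {0, 3}) and
`nBC = nBD = nCD = fun b => {b + 1, b + 5}` (difference set {±1}); all six maps are their own transposes. What is
kernel-checked (`decide` on `Fin 6`, and the product-finset bookkeeping of the g-fold blow-up for THIS design):

* `hex_degree`, `hex_transpose`, `hex_triangleFree` — flat (2, 6), triangle-free (both kinds of triples);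
* `hex_fourCycles` — each cyclic order carries 24 transversal 4-cycles (the three orders are one expression),
  ΣN(C₄) = 72; `hex_thmL_eq` — `12 t d³ = 2 ΣN(C₄) + 3 t² d²` at (2, 6) (576 = 144 + 432): THEOREM L is ATTAINED at
  `x = t/d = 3` as well (x = 2: `FlatDesignBlowUp`/`FlatDesignTwiceMargin`; x = 5/2: `FlatDesignPentagon`);
* `hexBlowUp_flat`, `hexBlowUp_transpose`, `hexBlowUp_triangleFree`, `hexBlowUp_fourCycles`, `hexBlowUp_thmL_eq` —
  the g-fold blow-up on `Fin 6 × G` is a flat (2g, 6g) triangle-free design with `24 g⁴` 4-cycles per cyclic order,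
  ΣN(C₄) = 72 g⁴, and equality in THEOREM L: the bound is attained at EVERY `(d, t) = (2g, 6g)`, i.e. on the ray
  `t = 3d`, `d` even (for odd `d` the bound `(3/2) t d² (4d − t) = (9/2) d⁴` is not an integer there). With the
  tree's inequality the minimum of ΣN(C₄) over flat triangle-free (2g, 6g) designs is exactly `72 g⁴ = 4.5 d⁴` =
  N7F §3.9 (d)'s «uncorrelated value 3x/(x−1) at x = 3» (consequence; not restated as a theorem here).

HONEST FRAMING: finite combinatorics; nothing here is a statement about a variety, a sheaf or a Hodge class; the
identification with «flat K-secant coordinate skeleta» lives in N7F §3.6–§3.9. Nothing in this file says that HC,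
HC_CM or HC_AV holds; no door ∕ tier ∕ report sentence of the cell is a consequence of this file alone. This file
imports neither the tree leg of THEOREM L nor the companion legs (it restates no statement of theirs).
-/

namespace Summit.Ventures.HSemireg.FlatDesignHexagon

open Finset

section Hexagon

/-- The hexagon design is 2-regular: both kinds of maps have 2-element values. -/
theorem hex_degree : (∀ a : Fin 6, ({a, a + 3} : Finset (Fin 6)).card = 2) ∧
    ∀ b : Fin 6, ({b + 1, b + 5} : Finset (Fin 6)).card = 2 := by
  constructor <;> decide

/-- The maps `b ↦ {b + 1, b + 5}` (pairs `BC`, `BD`, `CD`) are their own transposes (so are the maps `a ↦ {a, a + 3}`, not needed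
by THEOREM L's hypotheses). -/
theorem hex_transpose : ∀ b c : Fin 6, c ∈ ({b + 1, b + 5} : Finset (Fin 6)) ↔ b ∈ ({c + 1, c + 5} : Finset (Fin 6)) := by
  decide

/-- The hexagon design is triangle-free: the triples `ABC, ABD, ACD` (shape: `{a, a+3}`, `{b+1, b+5}`, `{a, a+3}`)
and `BCD` (three times `{·+1, ·+5}`) carry no triangle. -/
theorem hex_triangleFree :
    (∀ a b c : Fin 6, b ∈ ({a, a + 3} : Finset (Fin 6)) → c ∈ ({b + 1, b + 5} : Finset (Fin 6)) →
      c ∉ ({a, a + 3} : Finset (Fin 6))) ∧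
    (∀ b c e : Fin 6, c ∈ ({b + 1, b + 5} : Finset (Fin 6)) → e ∈ ({c + 1, c + 5} : Finset (Fin 6)) →
      e ∉ ({b + 1, b + 5} : Finset (Fin 6))) := by
  constructor <;> decide

/-- Each cyclic order of the hexagon design carries exactly 24 transversal 4-cycles (the orders `(A B C D)`,
`(A B D C)`, `(A C B D)` of the tree leg are the same expression here), so ΣN(C₄) = 72. -/
theorem hex_fourCycles :
    (∑ a : Fin 6, ∑ b ∈ ({a, a + 3} : Finset (Fin 6)), ∑ e ∈ ({a, a + 3} : Finset (Fin 6)),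
        (({b + 1, b + 5} : Finset (Fin 6)) ∩ ({e + 1, e + 5} : Finset (Fin 6))).card) = 24 := by
  decide

/-- **THEOREM L is attained at (d, t) = (2, 6).** `12 · 6 · 2³ = 2 · (24 + 24 + 24) + 3 · 6² · 2²` (576 = 144 + 432),
with the three cyclic-order sums written exactly in the shape of `FlatTriangleFreeFourCycles.twelve_mul_le`. -/
theorem hex_thmL_eq :
    12 * 6 * 2 ^ 3 =
      2 * ((∑ a : Fin 6, ∑ b ∈ ({a, a + 3} : Finset (Fin 6)), ∑ e ∈ ({a, a + 3} : Finset (Fin 6)),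
              (({b + 1, b + 5} : Finset (Fin 6)) ∩ ({e + 1, e + 5} : Finset (Fin 6))).card)
          + (∑ a : Fin 6, ∑ b ∈ ({a, a + 3} : Finset (Fin 6)), ∑ c ∈ ({a, a + 3} : Finset (Fin 6)),
              (({b + 1, b + 5} : Finset (Fin 6)) ∩ ({c + 1, c + 5} : Finset (Fin 6))).card)
          + (∑ a : Fin 6, ∑ c ∈ ({a, a + 3} : Finset (Fin 6)), ∑ e ∈ ({a, a + 3} : Finset (Fin 6)),
              (({c + 1, c + 5} : Finset (Fin 6)) ∩ ({e + 1, e + 5} : Finset (Fin 6))).card))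
        + 3 * 6 ^ 2 * 2 ^ 2 := by
  rw [hex_fourCycles]
  norm_num

end Hexagon

section HexagonBlowUp

variable {G : Type*} [Fintype G]

/-- **The g-fold blow-up of the hexagon is a flat (2g, 6g) design**: `6 g` levels per coordinate, every level of
degree `2 g` for both kinds of maps. -/
theorem hexBlowUp_flat :
    Fintype.card (Fin 6 × G) = 6 * Fintype.card G ∧
    (∀ p : Fin 6 × G, (({p.1, p.1 + 3} : Finset (Fin 6)) ×ˢ (univ : Finset G)).card = 2 * Fintype.card G) ∧
    ∀ p : Fin 6 × G, (({p.1 + 1, p.1 + 5} : Finset (Fin 6)) ×ˢ (univ : Finset G)).card = 2 * Fintype.card G := by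
  refine ⟨by rw [Fintype.card_prod, Fintype.card_fin], fun p => ?_, fun p => ?_⟩
  · rw [card_product, hex_degree.1 p.1, card_univ]
  · rw [card_product, hex_degree.2 p.1, card_univ]

/-- The blown-up maps `p ↦ {p.1 + 1, p.1 + 5} ×ˢ univ` are their own transposes. -/
theorem hexBlowUp_transpose : ∀ p q : Fin 6 × G,
    q ∈ ({p.1 + 1, p.1 + 5} : Finset (Fin 6)) ×ˢ (univ : Finset G) ↔
      p ∈ ({q.1 + 1, q.1 + 5} : Finset (Fin 6)) ×ˢ (univ : Finset G) := by
  intro p q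
  simp only [mem_product, mem_univ, and_true]
  exact hex_transpose p.1 q.1

/-- **The blown-up hexagon is triangle-free** (both kinds of triples): a triangle would project to one of the
hexagon design. -/
theorem hexBlowUp_triangleFree :
    (∀ p q r : Fin 6 × G, q ∈ ({p.1, p.1 + 3} : Finset (Fin 6)) ×ˢ (univ : Finset G) →
      r ∈ ({q.1 + 1, q.1 + 5} : Finset (Fin 6)) ×ˢ (univ : Finset G) →
        r ∉ ({p.1, p.1 + 3} : Finset (Fin 6)) ×ˢ (univ : Finset G)) ∧
    ∀ p q r : Fin 6 × G, q ∈ ({p.1 + 1, p.1 + 5} : Finset (Fin 6)) ×ˢ (univ : Finset G) →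
      r ∈ ({q.1 + 1, q.1 + 5} : Finset (Fin 6)) ×ˢ (univ : Finset G) →
        r ∉ ({p.1 + 1, p.1 + 5} : Finset (Fin 6)) ×ˢ (univ : Finset G) := by
  constructor
  · intro p q r hq hr hr'
    simp only [mem_product, mem_univ, and_true] at hq hr hr'
    exact hex_triangleFree.1 _ _ _ hq hr hr'
  · intro p q r hq hr hr'
    simp only [mem_product, mem_univ, and_true] at hq hr hr'
    exact hex_triangleFree.2 _ _ _ hq hr hr'

variable [DecidableEq G]

/-- **The blown-up hexagon has `24 g⁴` transversal 4-cycles in each cyclic order** (ΣN(C₄) = 72 g⁴): one factor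
`g` for the copies of each of the four levels of a 4-cycle of the hexagon design. -/
theorem hexBlowUp_fourCycles :
    (∑ p : Fin 6 × G, ∑ q ∈ ({p.1, p.1 + 3} : Finset (Fin 6)) ×ˢ (univ : Finset G),
        ∑ s ∈ ({p.1, p.1 + 3} : Finset (Fin 6)) ×ˢ (univ : Finset G),
          ((({q.1 + 1, q.1 + 5} : Finset (Fin 6)) ×ˢ (univ : Finset G)) ∩
            (({s.1 + 1, s.1 + 5} : Finset (Fin 6)) ×ˢ (univ : Finset G))).card) = 24 * Fintype.card G ^ 4 := by
  have hinter : ∀ (b e : Fin 6), (({b + 1, b + 5} : Finset (Fin 6)) ×ˢ (univ : Finset G)) ∩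
      (({e + 1, e + 5} : Finset (Fin 6)) ×ˢ (univ : Finset G))
        = (({b + 1, b + 5} : Finset (Fin 6)) ∩ {e + 1, e + 5}) ×ˢ (univ : Finset G) := by
    intro b e
    rw [product_inter_product, inter_self]
  have key : (∑ p : Fin 6 × G, ∑ q ∈ ({p.1, p.1 + 3} : Finset (Fin 6)) ×ˢ (univ : Finset G),
      ∑ s ∈ ({p.1, p.1 + 3} : Finset (Fin 6)) ×ˢ (univ : Finset G),
        ((({q.1 + 1, q.1 + 5} : Finset (Fin 6)) ×ˢ (univ : Finset G)) ∩
          (({s.1 + 1, s.1 + 5} : Finset (Fin 6)) ×ˢ (univ : Finset G))).card)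
      = Fintype.card G ^ 4 * ∑ a : Fin 6, ∑ b ∈ ({a, a + 3} : Finset (Fin 6)),
          ∑ e ∈ ({a, a + 3} : Finset (Fin 6)),
            (({b + 1, b + 5} : Finset (Fin 6)) ∩ ({e + 1, e + 5} : Finset (Fin 6))).card := by
    simp_rw [hinter, card_product, card_univ]
    simp_rw [sum_product, sum_const, card_univ, smul_eq_mul]
    rw [Fintype.sum_prod_type]
    simp_rw [sum_const, card_univ, smul_eq_mul]
    simp_rw [mul_sum]
    refine sum_congr rfl fun a _ => sum_congr rfl fun b _ => sum_congr rfl fun e _ => ?_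
    ring
  rw [key, hex_fourCycles, mul_comm]

/-- **THEOREM L is attained at every (d, t) = (2g, 6g).** With `d = 2g`, `t = 6g` and the three (equal) cyclic-order
sums of the blown-up hexagon: `12 t d³ = 2 (N₁ + N₂ + N₃) + 3 t² d²` (both sides `576 g⁴`). Together with the tree's
`twelve_mul_le` the minimum of ΣN(C₄) over flat triangle-free (2g, 6g) designs is therefore exactly `72 g⁴`. -/
theorem hexBlowUp_thmL_eq :
    12 * (6 * Fintype.card G) * (2 * Fintype.card G) ^ 3 =
      2 * ((∑ p : Fin 6 × G, ∑ q ∈ ({p.1, p.1 + 3} : Finset (Fin 6)) ×ˢ (univ : Finset G),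
              ∑ s ∈ ({p.1, p.1 + 3} : Finset (Fin 6)) ×ˢ (univ : Finset G),
                ((({q.1 + 1, q.1 + 5} : Finset (Fin 6)) ×ˢ (univ : Finset G)) ∩
                  (({s.1 + 1, s.1 + 5} : Finset (Fin 6)) ×ˢ (univ : Finset G))).card)
          + (∑ p : Fin 6 × G, ∑ q ∈ ({p.1, p.1 + 3} : Finset (Fin 6)) ×ˢ (univ : Finset G),
              ∑ r ∈ ({p.1, p.1 + 3} : Finset (Fin 6)) ×ˢ (univ : Finset G),
                ((({q.1 + 1, q.1 + 5} : Finset (Fin 6)) ×ˢ (univ : Finset G)) ∩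
                  (({r.1 + 1, r.1 + 5} : Finset (Fin 6)) ×ˢ (univ : Finset G))).card)
          + (∑ p : Fin 6 × G, ∑ r ∈ ({p.1, p.1 + 3} : Finset (Fin 6)) ×ˢ (univ : Finset G),
              ∑ s ∈ ({p.1, p.1 + 3} : Finset (Fin 6)) ×ˢ (univ : Finset G),
                ((({r.1 + 1, r.1 + 5} : Finset (Fin 6)) ×ˢ (univ : Finset G)) ∩
                  (({s.1 + 1, s.1 + 5} : Finset (Fin 6)) ×ˢ (univ : Finset G))).card))
        + 3 * (6 * Fintype.card G) ^ 2 * (2 * Fintype.card G) ^ 2 := by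
  rw [hexBlowUp_fourCycles]
  ring

end HexagonBlowUp

end Summit.Ventures.HSemireg.FlatDesignHexagon
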